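import Mathlib
import Summits.KontsevichZagierPeriods.Zeta5Search.Families.DualSpanProdCoeff
import Summits.KontsevichZagierPeriods.Zeta5Search.WedgeDictionaryThreeTerm
import Literature.RingTheory.MvPolynomial.WeightOperators
import HarnessLib

/-!
# ζ(5) search — Families: the dual constant term satisfies gen-1's STAR(3,5) relation, UNCONDITIONALLY —
# translation invariance of one marked point of the dual configuration

HONEST FRAMING: systematic search; no irrationality claim unless certified.  Cell `pub-zeta5`, certifier 2
(cert-2 g7, 2026-08-21).  Identities between integers (coefficients of an integer polynomial); no conjecture node is
used; nothing about `ζ(5)`; no number of record moves.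

CONTEXT.  P2 g6's CONJECTURE D-exact (`Families/DualConstantTerm`: `|Q(a)| = dualConstantTerm a`) would make the
dual constant term `CT(a) = [g^B] Λ-num_A` inherit every three-term relation of Brown–Zudilin's leading coefficient
`Q`, in particular gen-1's STAR relations (`WedgeDictionaryThreeTerm.DictStar`, first component; fam-elim
`Elimination.dictStar_holds`).  Exact numerics (cert-2 g7, `HOME/cert-2/g7/dexact/star_test.py`: 3 294 STAR and 602
PENCIL triples, 0 exceptions) say it does.  This file PROVES the first such relation for `CT` directly on the
torus side, for every parameter vector, with no hypothesis beyond the cone conditions: the mechanism is that the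
constant term of a `θ`-divergence vanishes (`[m](X_w ∂_w F) = m_w [m]F`), applied to the vector field
`∂/∂w₅ = ∂_{g₄} − ∂_{g₅}` that translates the marked point `w₅` of the dual configuration — only the span `{2,3,4}`
(exponent `A₃`) ends at `g₄` without containing `g₅`, so `(∂₅ − ∂₄) Λ-num_A = −A₃ · Λ-num_{A−e₃}` (Leibniz).
This is the torus analogue of Brown–Zudilin's "integrand-trivial" contiguity and the first step of the
uniform-proof plan `HOME/cert-2/g7/DEXACT-PLAN.md` (D-exact ⟸ STAR/PENCIL for `CT` + 2-of-3 propagation +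
decided base cases).

CONTENTS (standard axioms only):
* (reused) `Literature.RingTheory.MvPolynomial.coeff_X_mul_pderiv` — `[m](X i · ∂_i p) = m_i · [m]p`;
* `DualCT.dualSpanProd_eq_mul_F3`, `DualCT.dualSpanProd_slot3`, `DualCT.dualSpanProd_update5` — bookkeeping of the
  exponent moves `A ↦ A − e₃`, `A ↦ A + e₂ − e₃` (slot 3) and of the invisible exponent `A₅`;
* `DualCT.pderiv_five_sub_four` — `(∂₅ − ∂₄) dualSpanProd A = −A₃ · dualSpanProd (A − e₃)` (`A₃ ≥ 1`);
* **`DualCT.coeff_star35`** — `(A₃ − B₅)·[g^B]N_A + (B₄+1)·[g^{B+e₄−e₅}]N_A − A₃·[g^B]N_{A+e₂−e₃} = 0`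
  (`A₃, B₅ ≥ 1`);
* **`dualConstantTerm_star35`** — for `a` with `bzNum a, bzDen a ≥ 0`, `a₄ ≥ 1`, `b₃₅(a) ≥ 1`:
  `(A₃ − B₅)·CT(a) + (B₄+1)·CT(a − s₅) − A₃·CT(a − s₃) = 0` (`a − s_k = a + slotDown k`);
* **`dualConstantTerm_star35'`** — the same in gen-1's vocabulary: `κ(3,5)·CT(a) + χ₅Π₅·CT(a−s₅) − χ₃Π₃·CT(a−s₃) = 0`
  (gen-1's three coefficients share the factor `a₈ + 1`; the two sign changes w.r.t. `DictStar` are the sign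
  `(−1)^{Σp}` of `Q` flipping under both moves).
Certificate in Laurent form (exact check on 200 random `(a, g)`, `HOME/cert-2/g7/dexact/cert35_check.py`):
`(A₃−B₅) + (B₄+1)g₅/g₄ − A₃L₂/L₃ = θ₄(C₄) + C₄θ₄log Λ + θ₅(C₅) + C₅θ₅log Λ` with `C₄ = −g₅/g₄`, `C₅ = 1`.
-/

noncomputable section
open MvPolynomial Finset
open Literature.RingTheory.MvPolynomial (coeff_X_mul_pderiv)

namespace Summit.KontsevichZagierPeriods.Zeta5Search.Families.Cellular
namespace DualCT

/-- `dualSpanProd A = dualSpanProd (A with A₃−1) · (g₂+g₃+g₄)` when `A₃ ≥ 1`. -/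
theorem dualSpanProd_eq_mul_F3 (A : Fin 8 → ℕ) (h : 1 ≤ A 3) :
    dualSpanProd A = dualSpanProd (Function.update A 3 (A 3 - 1)) * (X 2 + X 3 + X 4) := by
  unfold dualSpanProd
  obtain ⟨n, hn⟩ : ∃ n, A 3 = n + 1 := ⟨A 3 - 1, by omega⟩
  simp only [Function.update_self, Function.update_of_ne (by decide : (0 : Fin 8) ≠ 3),
    Function.update_of_ne (by decide : (1 : Fin 8) ≠ 3), Function.update_of_ne (by decide : (2 : Fin 8) ≠ 3),
    Function.update_of_ne (by decide : (6 : Fin 8) ≠ 3), Function.update_of_ne (by decide : (7 : Fin 8) ≠ 3), hn,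
    Nat.add_sub_cancel, pow_succ]
  ring

/-- The slot-3 neighbour: `dualSpanProd (A + e₂ − e₃) = dualSpanProd (A with A₃−1) · (g₂+g₃+g₄+g₅)`. -/
theorem dualSpanProd_slot3 (A : Fin 8 → ℕ) :
    dualSpanProd (Function.update (Function.update A 2 (A 2 + 1)) 3 (A 3 - 1)) =
      dualSpanProd (Function.update A 3 (A 3 - 1)) * (X 2 + X 3 + X 4 + X 5) := by
  unfold dualSpanProd
  simp only [Function.update_self, Function.update_of_ne (by decide : (0 : Fin 8) ≠ 3),
    Function.update_of_ne (by decide : (1 : Fin 8) ≠ 3), Function.update_of_ne (by decide : (2 : Fin 8) ≠ 3),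
    Function.update_of_ne (by decide : (6 : Fin 8) ≠ 3), Function.update_of_ne (by decide : (7 : Fin 8) ≠ 3),
    Function.update_of_ne (by decide : (0 : Fin 8) ≠ 2), Function.update_of_ne (by decide : (1 : Fin 8) ≠ 2),
    Function.update_of_ne (by decide : (6 : Fin 8) ≠ 2),
    Function.update_of_ne (by decide : (7 : Fin 8) ≠ 2), pow_succ]
  ring_nf

/-- **Translation of the marked point `w₅`** (`∂/∂w₅ = ∂_{g₄} − ∂_{g₅}` up to sign): on the dual span product,
`(∂₅ − ∂₄) Λ-num_A = −A₃ · Λ-num_{A − e₃}` — only the span `{2,3,4}` ends at `g₄` without containing `g₅`. -/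
theorem pderiv_five_sub_four (A : Fin 8 → ℕ) (h : 1 ≤ A 3) :
    pderiv 5 (dualSpanProd A) - pderiv 4 (dualSpanProd A) =
      -((A 3 : ℕ) : P6) * dualSpanProd (Function.update A 3 (A 3 - 1)) := by
  obtain ⟨n, hn⟩ : ∃ n, A 3 = n + 1 := ⟨A 3 - 1, by omega⟩
  unfold dualSpanProd
  simp only [Function.update_self, Function.update_of_ne (by decide : (0 : Fin 8) ≠ 3),
    Function.update_of_ne (by decide : (1 : Fin 8) ≠ 3), Function.update_of_ne (by decide : (2 : Fin 8) ≠ 3),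
    Function.update_of_ne (by decide : (6 : Fin 8) ≠ 3), Function.update_of_ne (by decide : (7 : Fin 8) ≠ 3),
    hn]
  simp only [pderiv_mul, pderiv_pow, map_add, pderiv_X_self, Nat.add_sub_cancel,
    pderiv_X_of_ne (show (0 : Fin 6) ≠ 5 by decide), pderiv_X_of_ne (show (1 : Fin 6) ≠ 5 by decide),
    pderiv_X_of_ne (show (2 : Fin 6) ≠ 5 by decide), pderiv_X_of_ne (show (3 : Fin 6) ≠ 5 by decide),
    pderiv_X_of_ne (show (4 : Fin 6) ≠ 5 by decide), pderiv_X_of_ne (show (0 : Fin 6) ≠ 4 by decide),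
    pderiv_X_of_ne (show (1 : Fin 6) ≠ 4 by decide), pderiv_X_of_ne (show (2 : Fin 6) ≠ 4 by decide),
    pderiv_X_of_ne (show (3 : Fin 6) ≠ 4 by decide), pderiv_X_of_ne (show (5 : Fin 6) ≠ 4 by decide)]
  push_cast
  ring

/-- **STAR(3,5) for the constant terms of the dual span product** (coefficient form; `A₃ ≥ 1`, `B₅ ≥ 1`):
`(A₃ − B₅)·[g^B]N_A + (B₄+1)·[g^{B+e₄−e₅}]N_A − A₃·[g^B]N_{A+e₂−e₃} = 0`.  Mechanism: the constant term of the
`θ`-divergence `θ₄(−(g₅/g₄)Λ) + θ₅(Λ)` vanishes; equivalently `X₄·(X₅∂₅N) − X₅·(X₄∂₄N) = −A₃·X₄X₅·N_{A−e₃}`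
(translation of the marked point `w₅` of the dual configuration). -/
theorem coeff_star35 (A : Fin 8 → ℕ) (B : Fin 6 →₀ ℕ) (hA : 1 ≤ A 3) (hB : 1 ≤ B 5) :
    ((A 3 : ℤ) - B 5) * coeff B (dualSpanProd A)
      + ((B 4 : ℤ) + 1) * coeff (B + Finsupp.single 4 1 - Finsupp.single 5 1) (dualSpanProd A)
      - (A 3 : ℤ) * coeff B (dualSpanProd (Function.update (Function.update A 2 (A 2 + 1)) 3 (A 3 - 1))) = 0 := by
  set N := dualSpanProd A with hNdef
  set M := dualSpanProd (Function.update A 3 (A 3 - 1)) with hMdef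
  have hN : N = M * (X 2 + X 3 + X 4) := dualSpanProd_eq_mul_F3 A hA
  have hN' : dualSpanProd (Function.update (Function.update A 2 (A 2 + 1)) 3 (A 3 - 1)) =
      M * (X 2 + X 3 + X 4 + X 5) := dualSpanProd_slot3 A
  have hD : pderiv 5 N - pderiv 4 N = -((A 3 : ℕ) : P6) * M := pderiv_five_sub_four A hA
  have key : X 4 * (X 5 * pderiv 5 N) - X 5 * (X 4 * pderiv 4 N) = C (-(A 3 : ℤ)) * (X 4 * (X 5 * M)) := by
    rw [map_neg, map_natCast]
    linear_combination (X 4 * X 5 : P6) * hD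
  -- supports / indices
  have h4 : (4 : Fin 6) ∈ (B + Finsupp.single 4 1).support := by simp
  have h5 : (5 : Fin 6) ∈ (B + Finsupp.single 4 1).support := by
    rw [Finsupp.mem_support_iff]; simp; omega
  have h5' : (5 : Fin 6) ∈ B.support := by rw [Finsupp.mem_support_iff]; omega
  have e4 : B + Finsupp.single 4 1 - Finsupp.single 4 1 = B := add_tsub_cancel_right _ _
  have e45 : ((B + Finsupp.single 4 1 - Finsupp.single 5 1 : Fin 6 →₀ ℕ) 4 : ℕ) = B 4 + 1 := by
    simp [Finsupp.coe_tsub]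
  -- take the coefficient of g^{B+e₄} in `key`
  have hk := congrArg (coeff (B + Finsupp.single 4 1)) key
  simp only [coeff_sub, coeff_C_mul] at hk
  rw [coeff_X_mul', if_pos h4, e4, coeff_X_mul_pderiv, coeff_X_mul', if_pos h5, coeff_X_mul_pderiv, e45,
    coeff_X_mul', if_pos h4, e4, coeff_X_mul', if_pos h5'] at hk
  -- the slot-3 neighbour: `[g^B](M·F₂) = [g^B]N + [g^{B−e₅}]M`
  have hs : coeff B (dualSpanProd (Function.update (Function.update A 2 (A 2 + 1)) 3 (A 3 - 1))) =
      coeff B N + coeff (B - Finsupp.single 5 1) M := by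
    rw [hN', hN, show M * (X 2 + X 3 + X 4 + X 5) = M * (X 2 + X 3 + X 4) + M * X 5 by ring, coeff_add,
      coeff_mul_X', if_pos h5']
  rw [hs]
  push_cast at hk ⊢
  linear_combination -hk


end DualCT

open DualCT
open Summit.KontsevichZagierPeriods.Zeta5Search.WedgeDictionary (slotDown starKappa fanCoeff)
open Literature.NumberTheory.Irrationality
open Literature.NumberTheory.Irrationality.BrownZudilin2022 (bOfA)

/-- `dualSpanProd` does not see the exponent at position 5 (an edge through `∞`). -/
theorem DualCT.dualSpanProd_update5 (A : Fin 8 → ℕ) (v : ℕ) :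
    dualSpanProd (Function.update A 5 v) = dualSpanProd A := by
  unfold dualSpanProd
  simp [Function.update_of_ne]

/-- **The dual constant term satisfies gen-1's STAR(3,5)** (divided by the common factor `a₈ + 1` of its three
coefficients): for `a` with `A = bzNum a ≥ 0`, `B = bzDen a ≥ 0`, `A₃ = a₄ ≥ 1`, `B₅ = b₃₅(a) ≥ 1`,
`(A₃ − B₅)·CT(a) + (B₄ + 1)·CT(a − s₅) + (−A₃)·CT(a − s₃) = 0`
(`a − s₅ = a + slotDown 5`, `a − s₃ = a + slotDown 3`).  UNCONDITIONAL — no conjecture node is used. -/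
theorem dualConstantTerm_star35 (a : Fin 8 → ℤ) (hA : ∀ i, 0 ≤ bzNum a i) (hB : ∀ i, 0 ≤ bzDen a i)
    (h3 : 1 ≤ bzNum a 3) (h5 : 1 ≤ bzDen a 5) :
    (bzNum a 3 - bzDen a 5) * dualConstantTerm a + (bzDen a 4 + 1) * dualConstantTerm (a + slotDown 5)
      - bzNum a 3 * dualConstantTerm (a + slotDown 3) = 0 := by
  -- the data of the three points
  set A : Fin 8 → ℕ := fun i => (bzNum a i).toNat with hAdef
  set B : Fin 6 →₀ ℕ :=
    Finsupp.equivFunOnFinite.symm fun w : Fin 6 => (bzDen a (Fin.castLE (by norm_num) w)).toNat with hBdef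
  have hA3 : 1 ≤ A 3 := by
    simp only [hAdef]; have := hA 3; omega
  have hB5 : 1 ≤ B 5 := by
    simp only [hBdef, Finsupp.coe_equivFunOnFinite_symm]; have := hB 5
    change 1 ≤ (bzDen a 5).toNat; omega
  have ha2 : 0 ≤ a 2 := by simpa [bzNum] using hA 2
  have ha4 : 0 ≤ a 4 := by simpa [bzNum] using hA 4
  have ha5 : 0 ≤ a 5 := by simpa [bzNum] using hA 5
  have ha3 : 1 ≤ a 3 := by simpa [bzNum] using h3
  have e0 : dualConstantTerm a = coeff B (dualSpanProd A) := rfl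
  have e5 : dualConstantTerm (a + slotDown 5) =
      coeff (B + Finsupp.single 4 1 - Finsupp.single 5 1) (dualSpanProd A) := by
    unfold dualConstantTerm
    have hn : (fun i => (bzNum (a + slotDown 5) i).toNat) = Function.update A 5 ((bzNum a 5).toNat + 1) := by
      ext i
      fin_cases i <;> simp [hAdef, bzNum, slotDown, Function.update]
      all_goals omega
    have hd : (Finsupp.equivFunOnFinite.symm fun w : Fin 6 =>
          (bzDen (a + slotDown 5) (Fin.castLE (by norm_num) w)).toNat)
        = B + Finsupp.single 4 1 - Finsupp.single 5 1 := by
      ext w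
      have h4' := hB 4; have h5'' := hB 5; have h0 := hB 0; have h1 := hB 1; have h2 := hB 2; have h3' := hB 3
      fin_cases w <;>
        simp [hBdef, bzDen, slotDown, BrownZudilin2022.b24, BrownZudilin2022.b14, BrownZudilin2022.b57,
          BrownZudilin2022.b35, BrownZudilin2022.b36] at * <;> omega
    rw [hn, hd, DualCT.dualSpanProd_update5]
  have e3 : dualConstantTerm (a + slotDown 3) =
      coeff B (dualSpanProd (Function.update (Function.update A 2 (A 2 + 1)) 3 (A 3 - 1))) := by
    unfold dualConstantTerm
    have hn : (fun i => (bzNum (a + slotDown 3) i).toNat) =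
        Function.update (Function.update (Function.update A 2 (A 2 + 1)) 3 (A 3 - 1)) 4 ((bzNum a 4).toNat + 1) := by
      ext i
      fin_cases i <;> simp [hAdef, bzNum, slotDown, Function.update] <;> omega
    have hd : (Finsupp.equivFunOnFinite.symm fun w : Fin 6 =>
          (bzDen (a + slotDown 3) (Fin.castLE (by norm_num) w)).toNat) = B := by
      ext w
      fin_cases w <;>
        simp [hBdef, bzDen, slotDown, BrownZudilin2022.b24, BrownZudilin2022.b14, BrownZudilin2022.b57,
          BrownZudilin2022.b35, BrownZudilin2022.b36] <;> ring_nf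
    have hu : dualSpanProd (Function.update (Function.update (Function.update A 2 (A 2 + 1)) 3 (A 3 - 1)) 4
        ((bzNum a 4).toNat + 1)) = dualSpanProd (Function.update (Function.update A 2 (A 2 + 1)) 3 (A 3 - 1)) := by
      unfold dualSpanProd; simp [Function.update_of_ne]
    rw [hn, hd, hu]
  have key := coeff_star35 A B hA3 hB5
  have c3 : (bzNum a 3 : ℤ) = (A 3 : ℤ) := by simp only [hAdef]; have := hA 3; omega
  have c5 : (bzDen a 5 : ℤ) = (B 5 : ℤ) := by
    simp only [hBdef, Finsupp.coe_equivFunOnFinite_symm]; have := hB 5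
    change bzDen a 5 = ((bzDen a 5).toNat : ℤ); omega
  have c4 : (bzDen a 4 : ℤ) = (B 4 : ℤ) := by
    simp only [hBdef, Finsupp.coe_equivFunOnFinite_symm]; have := hB 4
    change bzDen a 4 = ((bzDen a 4).toNat : ℤ); omega
  rw [e0, e5, e3, c3, c5, c4]
  exact key

/-- The same relation in gen-1's STAR(3,5) vocabulary (`WedgeDictionaryThreeTerm`: `starKappa`, `fanCoeff` at the dual
point `P = b(a)`): `κ(3,5)·CT(a) + χ₅Π₅·CT(a − s₅) − χ₃Π₃·CT(a − s₃) = 0`.  The two sign changes relative to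
`DictStar`'s `κ·v(a) − χ_kΠ_k·v(a−s_k) + χ_iΠ_i·v(a−s_i)` are exactly the sign `(−1)^{Σp}` of `Q` flipping under both
moves, so this is the relation the SIGNED constant term must satisfy if D-exact holds — here proved
unconditionally. -/
theorem dualConstantTerm_star35' (a : Fin 8 → ℤ) (hA : ∀ i, 0 ≤ bzNum a i) (hB : ∀ i, 0 ≤ bzDen a i)
    (h3 : 1 ≤ bzNum a 3) (h5 : 1 ≤ bzDen a 5) :
    starKappa (bOfA a) 3 5 * dualConstantTerm a + fanCoeff (bOfA a) 5 * dualConstantTerm (a + slotDown 5)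
      - fanCoeff (bOfA a) 3 * dualConstantTerm (a + slotDown 3) = 0 := by
  have h := dualConstantTerm_star35 a hA hB h3 h5
  have e1 : starKappa (bOfA a) 3 5 = (a 7 + 1) * (bzNum a 3 - bzDen a 5) := by
    simp [starKappa, BrownZudilin2022.bOfA, bzNum, bzDen, BrownZudilin2022.b35]; ring
  have e2 : fanCoeff (bOfA a) 5 = (a 7 + 1) * (bzDen a 4 + 1) := by
    simp [fanCoeff, WedgeDictionary.chiOf, WedgeDictionary.nonEdgePartners, BrownZudilin2022.bOfA, bzDen,
      BrownZudilin2022.b57]; ring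
  have e3 : fanCoeff (bOfA a) 3 = (a 7 + 1) * bzNum a 3 := by
    simp [fanCoeff, WedgeDictionary.chiOf, WedgeDictionary.nonEdgePartners, BrownZudilin2022.bOfA, bzNum]; ring
  rw [e1, e2, e3]
  linear_combination (a 7 + 1) * h

end Summit.KontsevichZagierPeriods.Zeta5Search.Families.Cellular
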